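import Summits.CriticalPhenomena.Ising3D.IsingColumnFaceL11CensusSegmentLinCands
import Summits.CriticalPhenomena.Ising3D.IsingColumnFaceL11CensusSigmaCellTrgFin

/-!
# The `TRG` census of §7.3 on the certified `Δε` segment as kernel facts, I: the enumerate-and-decide
machine and its soundness (cell `pub-ising3x`, seat recog-1; paper §7.1 / §7.3)

HONEST FRAMING: lottery ticket; floor = tightest certified 3D Ising CFT bounds; no exact-solution
claim without a proof. Island framing: certified exclusion region at stated derivative order and
assumptions; not a determination of the 3D Ising critical exponents beyond that.

§7.3 prints for `TRG` = `trgFullFamily 17 32` (`x = (p/q)·u·π^{a/2}·Γ_g^b·L^s`: the 6 432 monomials of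
FAMILIES-v1, `1 ≤ p, q ≤ 32`) the CENSUS NUMBERS «10 948 / 15 320 / 13 071» = the number of the recogniser's
DESCRIPTIONS (canonical tuples: `p/q` in lowest terms, `L` normalised to `log 2` when `s = 0`, `Γ_g` to `Γ(¼)`
when `b = 0`) with value in the closed sub-windows `[81/64, 13/10]`, `[13/10, 27/20]`, `[27/20, 2855/2048]`;
§7.1 files them as census numbers, not theorems. This module and `…SegmentTrgA/B/C/D.lean` make them KERNEL
FACTS by the enumerate-and-decide scheme of `…SegmentLin{,Cands,A,B,C}.lean`: for every monomial (certified
enclosure `trgGEncl` of `ExclusionSentencesTrgGamma`, rounded outward to 15 decimals: `trgEnclR`) and every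
`q` of its range the candidate numerators `p` are generated, each value is binned by rational comparisons
with the cut points (strictly off the interior cuts), and the kernel verifies that nothing is undecided.
Here (no heavy kernel evaluation): `trgCandsOf`, `trgSegPart g b` (one `Γ`-class), `trgSegAll` (fifteen
classes `trgGBList`), `trgBinOf` with SOUNDNESS `trgBin_spec`, `trgCanon`, `trgPrim`; COMPLETENESS
`mem_trgSegAll_of_mem_segment` (the `p`-range argument of `trgGExcludedGB_sound` and a `q`-range); the check
`trgSegCheck` / `trgSegCheck_spec`, `countP_trgSegAll`, `nodup_trgSegAll_snd`. No certificate, no datum, no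
σ–ε axiom; nothing is recognised (§1.6). Python twin: recog-1 gen 51 `twin_lintrg.py`.
lottery ticket; floor = tightest certified 3D Ising CFT bounds; no exact-solution claim without a proof.
-/


namespace Summit.CriticalPhenomena.Ising3D
namespace ColumnFaceL11
open Set Literature.MathematicalPhysics.QuantumFieldTheory.ConformalBootstrap3D

/-- A `TRG` description tuple `(p, q, u, a, g, b, L, s)` (the argument type of `trgGTupleVal`). [folklore] -/
abbrev TrgTuple : Type := ℕ × ℕ × ℕ × ℤ × ℕ × ℤ × ℕ × ℤ

/-! ### Classes, bins, candidates -/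
/-- The fifteen canonical `Γ`-classes `(g, b)`: `Γ(¼)^b`, `b ∈ [−4, 4]` (`b = 0` = no `Γ` factor), and
`Γ(⅓)^b`, `b ∈ {−3, …, 3} ∖ {0}`. [folklore] -/
def trgGBList : List (ℕ × ℤ) :=
  [(0, -4), (0, -3), (0, -2), (0, -1), (0, 0), (0, 1), (0, 2), (0, 3), (0, 4),
    (1, -3), (1, -2), (1, -1), (1, 1), (1, 2), (1, 3)]

/-- The eleven canonical `L`-classes `(L, s)`: `L^{−1}` and `L^{1}` for the five constants, and `s = 0`
normalised to `L = 0`. [folklore] -/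
def trgLSList : List (ℕ × ℤ) :=
  [(0, -1), (1, -1), (2, -1), (3, -1), (4, -1), (0, 0), (0, 1), (1, 1), (2, 1), (3, 1), (4, 1)]

/-- Membership in `trgGBList`. [folklore] -/
theorem mem_trgGBList_iff {g : ℕ} {b : ℤ} : (g, b) ∈ trgGBList ↔
    g ≤ 1 ∧ -(4 - (g : ℤ)) ≤ b ∧ b ≤ 4 - (g : ℤ) ∧ ¬(b = 0 ∧ g = 1) := by
  constructor
  · intro h; simp only [trgGBList, List.mem_cons, Prod.mk.injEq, List.not_mem_nil, or_false] at h
    rcases h with h|h|h|h|h|h|h|h|h|h|h|h|h|h|h <;> obtain ⟨rfl, rfl⟩ := h <;> norm_num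
  · rintro ⟨hg, hb1, hb2, hne⟩
    interval_cases g
    · interval_cases b <;> simp [trgGBList]
    · have hb1' : -3 ≤ b := by omega
      have hb2' : b ≤ 3 := by omega
      interval_cases b <;> simp_all [trgGBList]

/-- Membership in `trgLSList`. [folklore] -/
theorem mem_trgLSList_iff {L : ℕ} {s : ℤ} : (L, s) ∈ trgLSList ↔
    L ≤ 4 ∧ -1 ≤ s ∧ s ≤ 1 ∧ ¬(s = 0 ∧ 0 < L) := by
  constructor
  · intro h; simp only [trgLSList, List.mem_cons, Prod.mk.injEq, List.not_mem_nil, or_false] at h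
    rcases h with h|h|h|h|h|h|h|h|h|h|h <;> obtain ⟨rfl, rfl⟩ := h <;> norm_num
  · rintro ⟨hL, hs1, hs2, hne⟩
    interval_cases s
    · interval_cases L <;> simp [trgLSList]
    · have : L = 0 := by omega
      subst this; simp [trgLSList]
    · interval_cases L <;> simp [trgLSList]

/-- Classification of a candidate with value in `[p/q·m₁, p/q·m₂]` against the cut points of §7.3:
`0 / 1 / 2` = decidably inside that closed sub-window (strictly off the interior cuts), `3` = decidably
outside the segment, `4` = undecided. [folklore] -/
def trgBin (p : ℤ) (q : ℕ) (m : ℚ × ℚ) : ℕ :=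
  if (p : ℚ) / q * m.2 < segCutQ 0 || segCutQ 3 < (p : ℚ) / q * m.1 then 3
  else if segCutQ 0 ≤ (p : ℚ) / q * m.1 && (p : ℚ) / q * m.2 < segCutQ 1 then 0
  else if segCutQ 1 < (p : ℚ) / q * m.1 && (p : ℚ) / q * m.2 < segCutQ 2 then 1
  else if segCutQ 2 < (p : ℚ) / q * m.1 && (p : ℚ) / q * m.2 ≤ segCutQ 3 then 2
  else 4

/-- **Soundness of the bins** for a real `x ∈ [p/q·m₁, p/q·m₂]`. [folklore] -/
theorem trgBin_spec {p : ℤ} {q : ℕ} {m : ℚ × ℚ} {x : ℝ}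
    (h1 : (((p : ℚ) / q * m.1 : ℚ) : ℝ) ≤ x) (h2 : x ≤ (((p : ℚ) / q * m.2 : ℚ) : ℝ)) :
    (trgBin p q m = 0 → ((segCutQ 0 : ℚ) : ℝ) ≤ x ∧ x < ((segCutQ 1 : ℚ) : ℝ)) ∧
    (trgBin p q m = 1 → ((segCutQ 1 : ℚ) : ℝ) < x ∧ x < ((segCutQ 2 : ℚ) : ℝ)) ∧
    (trgBin p q m = 2 → ((segCutQ 2 : ℚ) : ℝ) < x ∧ x ≤ ((segCutQ 3 : ℚ) : ℝ)) ∧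
    (trgBin p q m = 3 → x < ((segCutQ 0 : ℚ) : ℝ) ∨ ((segCutQ 3 : ℚ) : ℝ) < x) := by
  unfold trgBin
  split_ifs with h3 h0 h1' h2'
  · simp only [Bool.or_eq_true, decide_eq_true_eq] at h3
    refine ⟨fun h => absurd h (by norm_num), fun h => absurd h (by norm_num),
      fun h => absurd h (by norm_num), fun _ => ?_⟩
    rcases h3 with h3 | h3
    · exact Or.inl (lt_of_le_of_lt h2 (by exact_mod_cast h3))
    · exact Or.inr (lt_of_lt_of_le (by exact_mod_cast h3) h1)
  · simp only [Bool.and_eq_true, decide_eq_true_eq] at h0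
    exact ⟨fun _ => ⟨le_trans (by exact_mod_cast h0.1) h1, lt_of_le_of_lt h2 (by exact_mod_cast h0.2)⟩,
      fun h => absurd h (by norm_num), fun h => absurd h (by norm_num), fun h => absurd h (by norm_num)⟩
  · simp only [Bool.and_eq_true, decide_eq_true_eq] at h1'
    exact ⟨fun h => absurd h (by norm_num),
      fun _ => ⟨lt_of_lt_of_le (by exact_mod_cast h1'.1) h1, lt_of_le_of_lt h2 (by exact_mod_cast h1'.2)⟩,
      fun h => absurd h (by norm_num), fun h => absurd h (by norm_num)⟩
  · simp only [Bool.and_eq_true, decide_eq_true_eq] at h2'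
    exact ⟨fun h => absurd h (by norm_num), fun h => absurd h (by norm_num),
      fun _ => ⟨lt_of_lt_of_le (by exact_mod_cast h2'.1) h1, le_trans h2 (by exact_mod_cast h2'.2)⟩,
      fun h => absurd h (by norm_num)⟩
  · exact ⟨fun h => absurd h (by norm_num), fun h => absurd h (by norm_num),
      fun h => absurd h (by norm_num), fun h => absurd h (by norm_num)⟩

/-- The rounded certified enclosure of the monomial `u·π^{a/2}·Γ_g^b·L^s`. [folklore] -/
def trgEnclR (u : ℕ) (a : ℤ) (g : ℕ) (b : ℤ) (L : ℕ) (s : ℤ) : ℚ × ℚ := roundOut (trgGEncl u a g b L s)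

/-- The bin of a tuple: `trgBin` on its monomial's rounded certified enclosure `trgEnclR`. [folklore] -/
def trgBinOf (e : TrgTuple) : ℕ :=
  match e with
  | (p, q, u, a, g, b, L, s) => trgBin (p : ℤ) q (trgEnclR u a g b L s)

/-- Lowest terms: `gcd(p, q) = 1`. [folklore] -/
def trgPrim (e : TrgTuple) : Bool := Nat.gcd e.1 e.2.1 == 1

/-- Canonical form of a description: `s = 0 ⇒ L = 0` and `b = 0 ⇒ g = 0` (the value does not depend on
`L` resp. `g` then; FAMILIES-v1 lists each monomial once). [folklore] -/
def trgCanon (e : TrgTuple) : Bool :=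
  match e with
  | (_, _, _, _, g, b, L, s) => !decide (s = 0 ∧ 0 < L) && !decide (b = 0 ∧ g = 1)

/-- Lower end of the `p` candidate range of an enclosure `m` and a denominator `q`. [folklore] -/
def trgPlo (m : ℚ × ℚ) (q : ℕ) : ℤ := max 1 ⌈(segCutQ 0 / m.2) * q⌉

/-- Upper end of the `p` candidate range. [folklore] -/
def trgPhi (m : ℚ × ℚ) (q : ℕ) : ℤ := if m.1 ≤ 0 then 32 else min 32 ⌊(segCutQ 3 / m.1) * q⌋

/-- Lower end of the `q` range: `p ≥ 1` and `p/q · m ≤ 2855/2048` force `q ≥ m₁ / (2855/2048)`. [folklore] -/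
def trgQlo (m : ℚ × ℚ) : ℕ := max 1 ⌈m.1 / segCutQ 3⌉.toNat

/-- Upper end of the `q` range: `p ≤ 32` and `81/64 ≤ p/q · m` force `q ≤ 32 m₂ / (81/64)`. [folklore] -/
def trgQhi (m : ℚ × ℚ) : ℕ := min 32 ⌊m.2 * 32 / segCutQ 0⌋.toNat

/-- Candidates of one monomial `(u, a, g, b, L, s)` with enclosure `m`: `q` in its range, `p` in the
outward-rounded range, tagged `(bin, lowest terms?)`. [folklore] -/
def trgCandsM (u : ℕ) (a : ℤ) (g : ℕ) (b : ℤ) (L : ℕ) (s : ℤ) (m : ℚ × ℚ) : List ((ℕ × Bool) × TrgTuple) :=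
  (List.range' (trgQlo m) (trgQhi m + 1 - trgQlo m)).flatMap fun q : ℕ =>
    (iccList (trgPlo m q) (trgPhi m q)).map fun p : ℤ =>
      ((trgBin p q m, Nat.gcd p.toNat q == 1), (p.toNat, q, u, a, g, b, L, s))

/-- Candidates of one monomial (empty for the excluded exponent triple `(a, b, s) = 0`). [folklore] -/
def trgCandsOf (g : ℕ) (b : ℤ) (u : ℕ) (a : ℤ) (L : ℕ) (s : ℤ) : List ((ℕ × Bool) × TrgTuple) :=
  if a = 0 ∧ b = 0 ∧ s = 0 then [] else trgCandsM u a g b L s (trgEnclR u a g b L s)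

/-- Part `(g, b)`: all monomials of that `Γ`-class (`u ≤ 2`, `a ∈ [−6, 6]`, `(L, s)` canonical). [folklore] -/
def trgSegPart (g : ℕ) (b : ℤ) : List ((ℕ × Bool) × TrgTuple) :=
  (List.range 3).flatMap fun u => (iccList (-6) 6).flatMap fun a =>
    trgLSList.flatMap fun Ls => trgCandsOf g b u a Ls.1 Ls.2

/-- The whole tagged candidate list (fifteen parts). [folklore] -/
def trgSegAll : List ((ℕ × Bool) × TrgTuple) := trgGBList.flatMap fun gb => trgSegPart gb.1 gb.2

/-- An integer code of a tuple, increasing along the generation order inside a part (only used to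
certify that a part has no duplicates). [folklore] -/
def trgCode (e : TrgTuple) : ℕ :=
  match e with
  | (p, q, u, a, _, _, L, s) => (((u * 13 + (a + 6).toNat) * 15 + ((s + 1) * 5 + L).toNat) * 33 + q) * 33 + p

/-- The kernel check of part `(g, b)`: every candidate decided (bin `≤ 3`), codes strictly increasing,
and `n₀ / n₁ / n₂` lowest-terms candidates in the three sub-window bins. [folklore] -/
def trgSegCheck (g : ℕ) (b : ℤ) (n0 n1 n2 : ℕ) : Bool :=
  let Lst := trgSegPart g b
  (Lst.all fun be => decide (be.1.1 ≤ 3)) && incrNat (Lst.map fun be => trgCode be.2) &&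
    (Lst.countP fun be => be.1.1 == 0 && be.1.2) == n0 && (Lst.countP fun be => be.1.1 == 1 && be.1.2) == n1 &&
    (Lst.countP fun be => be.1.1 == 2 && be.1.2) == n2

/-- What a passed part check gives. [folklore] -/
theorem trgSegCheck_spec {g : ℕ} {b : ℤ} {n0 n1 n2 : ℕ} (h : trgSegCheck g b n0 n1 n2 = true) :
    (∀ be ∈ trgSegPart g b, be.1.1 ≤ 3) ∧ ((trgSegPart g b).map Prod.snd).Nodup ∧
      (trgSegPart g b).countP (fun be => be.1.1 == 0 && be.1.2) = n0 ∧
      (trgSegPart g b).countP (fun be => be.1.1 == 1 && be.1.2) = n1 ∧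
      (trgSegPart g b).countP (fun be => be.1.1 == 2 && be.1.2) = n2 := by
  simp only [trgSegCheck, Bool.and_eq_true, List.all_eq_true, decide_eq_true_eq, beq_iff_eq] at h
  obtain ⟨⟨⟨⟨hall, hincr⟩, h0⟩, h1⟩, h2⟩ := h
  refine ⟨hall, ?_, h0, h1, h2⟩
  have e : (trgSegPart g b).map (fun be => trgCode be.2) = ((trgSegPart g b).map Prod.snd).map trgCode := by
    rw [List.map_map]; rfl
  rw [e] at hincr
  exact nodup_of_incrNat_map trgCode hincr

/-! ### Membership lemmas -/
/-- What `trgCandsOf` lists. [folklore] -/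
theorem mem_trgCandsOf_iff {g : ℕ} {b : ℤ} {u : ℕ} {a : ℤ} {L : ℕ} {s : ℤ} {be : (ℕ × Bool) × TrgTuple} :
    be ∈ trgCandsOf g b u a L s ↔ ¬(a = 0 ∧ b = 0 ∧ s = 0) ∧ ∃ (q : ℕ) (p : ℤ),
      (trgQlo (trgEnclR u a g b L s) ≤ q ∧ q ≤ trgQhi (trgEnclR u a g b L s)) ∧
      (trgPlo (trgEnclR u a g b L s) q ≤ p ∧ p ≤ trgPhi (trgEnclR u a g b L s) q) ∧
      be = ((trgBin p q (trgEnclR u a g b L s), Nat.gcd p.toNat q == 1), (p.toNat, q, u, a, g, b, L, s)) := by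
  unfold trgCandsOf trgCandsM
  by_cases h0 : a = 0 ∧ b = 0 ∧ s = 0
  · simp [h0]
  · rw [if_neg h0]
    simp only [List.mem_flatMap, List.mem_map, List.mem_range'_1, mem_iccList, h0, not_false_eq_true, true_and]
    constructor
    · rintro ⟨q, hq, p, hp, rfl⟩
      exact ⟨q, p, by omega, hp, rfl⟩
    · rintro ⟨q, p, hq, hp, rfl⟩
      exact ⟨q, by omega, p, hp, rfl⟩

/-- Membership in a part. [folklore] -/
theorem mem_trgSegPart_iff {g : ℕ} {b : ℤ} {be : (ℕ × Bool) × TrgTuple} :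
    be ∈ trgSegPart g b ↔ ∃ (u : ℕ) (a : ℤ) (L : ℕ) (s : ℤ), u ≤ 2 ∧ (-6 ≤ a ∧ a ≤ 6) ∧ (L, s) ∈ trgLSList ∧
      be ∈ trgCandsOf g b u a L s := by
  unfold trgSegPart
  simp only [List.mem_flatMap, List.mem_range, mem_iccList]
  exact ⟨fun ⟨u, hu, a, ha, ⟨L, s⟩, hLs, hbe⟩ => ⟨u, a, L, s, by omega, ha, hLs, hbe⟩,
    fun ⟨u, a, L, s, hu, ha, hLs, hbe⟩ => ⟨u, by omega, a, ha, (L, s), hLs, hbe⟩⟩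

/-- Membership in the whole list. [folklore] -/
theorem mem_trgSegAll_iff {be : (ℕ × Bool) × TrgTuple} :
    be ∈ trgSegAll ↔ ∃ (g : ℕ) (b : ℤ), (g, b) ∈ trgGBList ∧ be ∈ trgSegPart g b := by
  unfold trgSegAll; rw [List.mem_flatMap]
  exact ⟨fun ⟨⟨g, b⟩, hgb, hbe⟩ => ⟨g, b, hgb, hbe⟩, fun ⟨g, b, hgb, hbe⟩ => ⟨(g, b), hgb, hbe⟩⟩

/-- The shape of a candidate: tags = (`trgBinOf`, `trgPrim`), the tuple is in the table
`trgFullFamily 17 32` (`trgGTupleOK`) and canonical, and its `Γ`-class is the part's. [folklore] -/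
theorem trgSegAll_shape {be : (ℕ × Bool) × TrgTuple} {g : ℕ} {b : ℤ} (hgb : (g, b) ∈ trgGBList)
    (h : be ∈ trgSegPart g b) :
    be = ((trgBinOf be.2, trgPrim be.2), be.2) ∧ trgGTupleOK 17 32 be.2 = true ∧ trgCanon be.2 = true ∧
      be.2.2.2.2.2.1 = g ∧ be.2.2.2.2.2.2.1 = b := by
  obtain ⟨u, a, L, s, hu, ha, hLs, hbe⟩ := mem_trgSegPart_iff.mp h
  obtain ⟨hne, q, p, hq, hp, rfl⟩ := mem_trgCandsOf_iff.mp hbe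
  obtain ⟨hg, hb1, hb2, hbg⟩ := mem_trgGBList_iff.mp hgb
  obtain ⟨hL, hs1, hs2, hsL⟩ := mem_trgLSList_iff.mp hLs
  have hp1 : 1 ≤ p := le_trans (le_max_left _ _) hp.1
  have hp32 : p ≤ 32 := by
    have h2 := hp.2; unfold trgPhi at h2
    split_ifs at h2 with hle
    · exact h2
    · exact le_trans h2 (min_le_left _ _)
  have hq : 1 ≤ q ∧ q ≤ 32 :=
    ⟨le_trans (Nat.le_max_left _ _) hq.1, le_trans hq.2 (Nat.min_le_left _ _)⟩
  have hpn : ((p.toNat : ℕ) : ℤ) = p := Int.toNat_of_nonneg (by omega)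
  refine ⟨?_, ?_, ?_, rfl, rfl⟩
  · simp only [trgBinOf, trgPrim, hpn]
  · simp only [trgGTupleOK, Bool.and_eq_true, decide_eq_true_eq]
    refine ⟨⟨⟨⟨⟨⟨⟨⟨⟨⟨⟨⟨⟨⟨by omega, by omega⟩, hq.1⟩, hq.2⟩, hu⟩, hL⟩, hg⟩, ha.1⟩, ha.2⟩, hb1⟩, hb2⟩, hs1⟩,
      hs2⟩, by omega⟩, ?_⟩
    have h1 : a.natAbs ≤ 6 := by omega
    have h2 : b.natAbs ≤ 4 := by omega
    have h3 : s.natAbs ≤ 1 := by omega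
    split_ifs <;> omega
  · simp only [trgCanon, Bool.and_eq_true, Bool.not_eq_true', decide_eq_false_iff_not]
    exact ⟨hsL, hbg⟩

/-- The `Γ`-class of a candidate of the whole list is a listed class, determined by the tuple. [folklore] -/
theorem trgSegAll_class {be : (ℕ × Bool) × TrgTuple} (h : be ∈ trgSegAll) :
    (be.2.2.2.2.2.1, be.2.2.2.2.2.2.1) ∈ trgGBList ∧ be ∈ trgSegPart be.2.2.2.2.2.1 be.2.2.2.2.2.2.1 := by
  obtain ⟨g, b, hgb, hbe⟩ := mem_trgSegAll_iff.mp h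
  obtain ⟨-, -, -, rfl, rfl⟩ := trgSegAll_shape hgb hbe
  exact ⟨hgb, hbe⟩

/-! ### Completeness -/
/-- **The `q`-range argument**: `q` lies in the range of the monomial when `p/q · y`, `y ∈ [m₁, m₂]`,
`1 ≤ p ≤ 32`, lies in the segment. [folklore] -/
theorem trg_q_mem_range {p q : ℕ} (hp1 : 1 ≤ p) (hph : p ≤ 32) (hq1 : 1 ≤ q) (hqh : q ≤ 32)
    {m : ℚ × ℚ} {y : ℝ} (hy0 : 0 < y) (hy1 : (m.1 : ℝ) ≤ y) (hy2 : y ≤ m.2)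
    (hlo : ((segCutQ 0 : ℚ) : ℝ) ≤ (p : ℝ) / q * y) (hhi : (p : ℝ) / q * y ≤ ((segCutQ 3 : ℚ) : ℝ)) :
    trgQlo m ≤ q ∧ q ≤ trgQhi m := by
  have hq0 : (0 : ℝ) < q := by exact_mod_cast hq1
  have hp0 : (0 : ℝ) < p := by exact_mod_cast hp1
  have hp1' : (1 : ℝ) ≤ p := by exact_mod_cast hp1
  have hp32 : (p : ℝ) ≤ 32 := by exact_mod_cast hph
  have hc0 : (0 : ℚ) < segCutQ 0 := by norm_num [segCutQ]
  have hc3 : (0 : ℚ) < segCutQ 3 := by norm_num [segCutQ]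
  have epy : (p : ℝ) * y = (p : ℝ) / q * y * q := by field_simp
  constructor
  · have h1 : (m.1 : ℝ) ≤ ((segCutQ 3 : ℚ) : ℝ) * q := by
      calc (m.1 : ℝ) ≤ y := hy1
        _ ≤ (p : ℝ) * y := le_mul_of_one_le_left hy0.le hp1'
        _ = (p : ℝ) / q * y * q := epy
        _ ≤ ((segCutQ 3 : ℚ) : ℝ) * q := mul_le_mul_of_nonneg_right hhi hq0.le
    have h2 : (m.1 / segCutQ 3 : ℚ) ≤ (q : ℚ) := by
      rw [div_le_iff₀ hc3]
      have : (m.1 : ℝ) ≤ (q : ℝ) * ((segCutQ 3 : ℚ) : ℝ) := by linarith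
      exact_mod_cast this
    have h3 : ⌈m.1 / segCutQ 3⌉ ≤ (q : ℤ) := Int.ceil_le.mpr (by exact_mod_cast h2)
    unfold trgQlo
    refine max_le hq1 ?_
    omega
  · have h1 : ((segCutQ 0 : ℚ) : ℝ) * q ≤ 32 * (m.2 : ℝ) := by
      calc ((segCutQ 0 : ℚ) : ℝ) * q ≤ (p : ℝ) / q * y * q := mul_le_mul_of_nonneg_right hlo hq0.le
        _ = (p : ℝ) * y := epy.symm
        _ ≤ 32 * (m.2 : ℝ) := by gcongr
    have h2 : (q : ℚ) ≤ m.2 * 32 / segCutQ 0 := by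
      rw [le_div_iff₀ hc0]
      have : (q : ℝ) * ((segCutQ 0 : ℚ) : ℝ) ≤ (m.2 : ℝ) * 32 := by linarith
      exact_mod_cast this
    have h3 : (q : ℤ) ≤ ⌊m.2 * 32 / segCutQ 0⌋ := Int.le_floor.mpr (by exact_mod_cast h2)
    unfold trgQhi
    refine le_min hqh ?_
    omega

/-- **The range argument** (as in `trgGExcludedGB_sound`): `p` lies in the candidate range of `(m, q)`
when `p/q · y`, `y ∈ [m₁, m₂]`, lies in the segment. [folklore] -/
theorem trg_p_mem_range {p q : ℕ} (hp1 : 1 ≤ p) (hph : p ≤ 32) (hq1 : 1 ≤ q)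
    {m : ℚ × ℚ} {y : ℝ} (hy0 : 0 < y) (hy1 : (m.1 : ℝ) ≤ y) (hy2 : y ≤ m.2)
    (hlo : ((segCutQ 0 : ℚ) : ℝ) ≤ (p : ℝ) / q * y) (hhi : (p : ℝ) / q * y ≤ ((segCutQ 3 : ℚ) : ℝ)) :
    trgPlo m q ≤ (p : ℤ) ∧ (p : ℤ) ≤ trgPhi m q := by
  have hq0 : (0 : ℝ) < q := by exact_mod_cast hq1
  have hpq0 : (0 : ℝ) < (p : ℝ) / q := by positivity
  constructor
  · refine max_le (by exact_mod_cast hp1) ?_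
    have hm2q : (0 : ℚ) < m.2 := by
      have : (0 : ℝ) < m.2 := lt_of_lt_of_le hy0 hy2
      exact_mod_cast this
    rw [Int.ceil_le, div_mul_eq_mul_div, div_le_iff₀ hm2q]
    have : ((segCutQ 0 : ℚ) : ℝ) * q ≤ p * m.2 := by
      have h' : (p : ℝ) / q * y ≤ p / q * m.2 := mul_le_mul_of_nonneg_left hy2 hpq0.le
      calc ((segCutQ 0 : ℚ) : ℝ) * q ≤ p / q * m.2 * q := mul_le_mul_of_nonneg_right (hlo.trans h') hq0.le
        _ = p * m.2 := by field_simp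
    exact_mod_cast this
  · unfold trgPhi
    split_ifs with hle
    · exact_mod_cast hph
    have hm0 : 0 < m.1 := lt_of_not_ge hle
    refine le_min (by exact_mod_cast hph) ?_
    rw [Int.le_floor, div_mul_eq_mul_div, le_div_iff₀ hm0]
    have : (p : ℝ) * m.1 ≤ ((segCutQ 3 : ℚ) : ℝ) * q := by
      have h' : (p : ℝ) / q * m.1 ≤ p / q * y := mul_le_mul_of_nonneg_left hy1 hpq0.le
      calc (p : ℝ) * m.1 = p / q * m.1 * q := by field_simp
        _ ≤ ((segCutQ 3 : ℚ) : ℝ) * q := mul_le_mul_of_nonneg_right (h'.trans hhi) hq0.le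
    exact_mod_cast this

/-- The value of a tuple lies in `p/q ·` (the rounded enclosure of its monomial). [folklore] -/
theorem trgGTupleVal_mem_encl (p q u : ℕ) (a : ℤ) (g : ℕ) (b : ℤ) (L : ℕ) (s : ℤ) :
    ((((p : ℤ) : ℚ) / q * (trgEnclR u a g b L s).1 : ℚ) : ℝ) ≤ trgGTupleVal (p, q, u, a, g, b, L, s) ∧
      trgGTupleVal (p, q, u, a, g, b, L, s) ≤ ((((p : ℤ) : ℚ) / q * (trgEnclR u a g b L s).2 : ℚ) : ℝ) := by
  obtain ⟨⟨hm1, hm2⟩, -⟩ := trgGVal_mem u a g b L s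
  obtain ⟨hr1, hr2⟩ := roundOut_sound hm1 hm2
  have hpq0 : (0 : ℝ) ≤ (p : ℝ) / q := by positivity
  unfold trgGTupleVal trgEnclR
  push_cast
  exact ⟨mul_le_mul_of_nonneg_left hr1 hpq0, mul_le_mul_of_nonneg_left hr2 hpq0⟩

/-- **Completeness.** A canonical tuple of the table `trgFullFamily 17 32` whose value lies in the segment
`[81/64, 2855/2048]` is a candidate (with its tags). [folklore] -/
theorem mem_trgSegAll_of_mem_segment {e : TrgTuple} (hok : trgGTupleOK 17 32 e = true)
    (hcan : trgCanon e = true) (hlo : ((segCutQ 0 : ℚ) : ℝ) ≤ trgGTupleVal e)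
    (hhi : trgGTupleVal e ≤ ((segCutQ 3 : ℚ) : ℝ)) : ((trgBinOf e, trgPrim e), e) ∈ trgSegAll := by
  obtain ⟨p, q, u, a, g, b, L, s⟩ := e
  simp only [trgGTupleOK, Bool.and_eq_true, decide_eq_true_eq] at hok
  obtain ⟨⟨⟨⟨⟨⟨⟨⟨⟨⟨⟨⟨⟨⟨hp1, hph⟩, hq1⟩, hqh⟩, hu⟩, hL⟩, hg⟩, ha1⟩, ha2⟩, hb1⟩, hb2⟩, hs1⟩, hs2⟩,
    hne⟩, -⟩ := hok
  simp only [trgCanon, Bool.and_eq_true, Bool.not_eq_true', decide_eq_false_iff_not] at hcan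
  obtain ⟨⟨hm1, hm2⟩, hm0⟩ := trgGVal_mem u a g b L s
  have hy0 : 0 < trgGVal u a g b L s := lt_of_lt_of_le (by exact_mod_cast hm0) hm1
  obtain ⟨hr1, hr2⟩ := roundOut_sound hm1 hm2
  have hval : trgGTupleVal (p, q, u, a, g, b, L, s) = (p : ℝ) / q * trgGVal u a g b L s := rfl
  rw [hval] at hlo hhi
  refine mem_trgSegAll_iff.mpr ⟨g, b, mem_trgGBList_iff.mpr ⟨hg, hb1, hb2, hcan.2⟩, ?_⟩
  refine mem_trgSegPart_iff.mpr ⟨u, a, L, s, hu, ⟨ha1, ha2⟩, mem_trgLSList_iff.mpr ⟨hL, hs1, hs2, hcan.1⟩, ?_⟩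
  refine mem_trgCandsOf_iff.mpr ⟨by omega, q, p, trg_q_mem_range hp1 hph hq1 hqh hy0 hr1 hr2 hlo hhi,
    trg_p_mem_range hp1 hph hq1 hy0 hr1 hr2 hlo hhi, ?_⟩
  simp only [trgBinOf, trgPrim, Int.toNat_natCast]

/-- A count over the whole list is the sum over the fifteen parts. [folklore] -/
theorem countP_trgSegAll (pr : (ℕ × Bool) × TrgTuple → Bool) :
    trgSegAll.countP pr = (trgSegPart 0 (-4)).countP pr + (trgSegPart 0 (-3)).countP pr +
      (trgSegPart 0 (-2)).countP pr + (trgSegPart 0 (-1)).countP pr + (trgSegPart 0 0).countP pr +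
      (trgSegPart 0 1).countP pr + (trgSegPart 0 2).countP pr + (trgSegPart 0 3).countP pr +
      (trgSegPart 0 4).countP pr + (trgSegPart 1 (-3)).countP pr + (trgSegPart 1 (-2)).countP pr +
      (trgSegPart 1 (-1)).countP pr + (trgSegPart 1 1).countP pr + (trgSegPart 1 2).countP pr +
      (trgSegPart 1 3).countP pr := by
  simp only [trgSegAll, trgGBList, List.flatMap_cons, List.flatMap_nil, List.countP_append, List.countP_nil]
  omega

/-- The tuples of the whole list have no duplicates, given the fifteen part facts (parts are disjoint by
the `Γ`-class, a component of the tuple). [folklore] -/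
theorem nodup_trgSegAll_snd (h : ∀ gb ∈ trgGBList, ((trgSegPart gb.1 gb.2).map Prod.snd).Nodup) :
    (trgSegAll.map Prod.snd).Nodup := by
  unfold trgSegAll
  rw [List.map_flatMap, List.nodup_flatMap]
  refine ⟨fun gb hgb => h gb hgb, ?_⟩
  have hnd : trgGBList.Nodup := by decide
  refine List.Pairwise.imp_of_mem ?_ hnd
  intro x y hx hy hxy e hex hey
  simp only [List.mem_map] at hex hey
  obtain ⟨bx, hbx, hbxe⟩ := hex
  obtain ⟨by_, hby, hbye⟩ := hey
  obtain ⟨x1, x2⟩ := x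
  obtain ⟨y1, y2⟩ := y
  obtain ⟨-, -, -, hgx, hbx'⟩ := trgSegAll_shape hx hbx
  obtain ⟨-, -, -, hgy, hby'⟩ := trgSegAll_shape hy hby
  rw [hbxe] at hgx hbx'
  rw [hbye] at hgy hby'
  exact hxy (by rw [← hgx, ← hbx', ← hgy, ← hby'])

end ColumnFaceL11
end Summit.CriticalPhenomena.Ising3D
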